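import Literature.AlgebraicGeometry.Motives.ZetaFunctionConstantFieldExtensionPoleOrder
import Literature.AlgebraicGeometry.Motives.TateClassesGaloisActionFiniteQuotient
import Literature.AlgebraicGeometry.Motives.AbstractHodgeTate
import HarnessLib

/-!
# `dim_K K·Aʳ(X) ≤ dim_K 𝒯ʳ(X) ≤ ord_{t=(q^m)^{-r}} Z(X ⊗ 𝔽_{q^m}, t) ≤ ν_r ≤ b_{2r}` for `m` divisible enough:
# the Tate classes sit in the generalized `1`-eigenspace of the Frobenius of a finite extension

Topic `Literature/AlgebraicGeometry/Motives`; THEOREMS ONLY (no definition, no instance, no named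
fact). Sequel of `Motives/TateClassesGaloisActionFiniteQuotient` (`Γ_k` acts on the Tate classes
`𝒯ʳ(X) = smoothInvariants (ρTwist)` through a finite cyclic quotient generated by the Frobenius: one
`N ≥ 1` with `φ_r^N = 1` on `𝒯ʳ(X)`) and of `Motives/ZetaFunctionConstantFieldExtensionPoleOrder` (row
g42-#8: `ord_{t=(q^m)^{-r}} Z(X ⊗ 𝔽_{q^m}, t) = dim_K H^{2r}(X)(r)_{(φ_r^m),1}`, bounded by and eventually
equal to `ν_r = #{j : α_{2r,j}/q^r ∈ μ_∞}`, `ν_r ≤ b_{2r}`, `ν_r ≡ b_{2r} (mod 2)`).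

## Sources, verbatim

J. S. Milne, *The Tate conjecture over finite fields (AIM talk)* [Milne2007TateFiniteFieldsAIM], §1
p. 3: «`H^{2r}(X, ℚ_ℓ(r))' := ⋃_{X₁/k₁} H^{2r}(X, ℚ_ℓ(r))^{Gal(𝔽/k₁)}`», «The conjecture implies that, for
any model `X₁/k₁`, the `ℚ_ℓ`-subspace `H^{2r}(X, ℚ_ℓ(r))^{Gal(𝔽/k₁)}` is spanned by the classes of algebraic
cycles on `X₁`; conversely, if this is true for all models `X₁/k₁` over (sufficiently large) finite fields
`k₁`, then `T^r(X, ℓ)` is true», «when the model `X₁/k₁` is replaced by `X_{1K}/K`, then its Frobenius map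
`π` is replaced by `π^{[K:k₁]}`», «I'll write `𝒯_ℓ^r(X)` for `H^{2r}(X, ℚ_ℓ(r))'` and call its elements the
Tate classes»; Th. 1.2 (pole order = rank).  J. Tate [Tate1994], §1 (Tate classes = classes fixed by an
open subgroup).  M. Schütt [Schuett2013TwoLecturesK3], §6 p. 79 («NS … can always be generated by
divisors defined over some finite extension of the base field … eigenvalues … take the shape `ζq`»).

## What is here (E-level; `E` a Galois Weil cohomology over the finite field `k`, no continuity of `ρ`)

For `X` smooth projective of dimension `d` and `r : ℕ`:
* **`exists_tateClasses_le_maxGenEigenspace_pow`**: there is `N ≥ 1` such that for every `m` with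
  `N ∣ m` the Tate classes lie in the generalized `1`-eigenspace (indeed the `1`-eigenspace) of
  `φ_r^m`, the twisted Frobenius relative to `𝔽_{q^m}`: `𝒯ʳ(X) ≤ Ker(φ_r^m − 1) ≤ H^{2r}(X)(r)_{(φ_r^m),1}`;
  hence **`dim_K K·Aʳ(X) ≤ dim_K 𝒯ʳ(X) ≤ dim_K H^{2r}(X)(r)_{(φ_r^m),1}`** (`exists_finrank_tateClasses_le`).
* Under the trace formula, `χ(φ) = q` and RH (`r ≤ d`): **`dim_K 𝒯ʳ(X) ≤ ord_{t=(q^m)^{-r}} Z(X ⊗ 𝔽_{q^m}, t)`**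
  for all `m ≥ 1` divisible by `N` (`exists_finrank_tateClasses_le_poleOrder_pow`), and, for an explicit
  integral model, **`dim_K 𝒯ʳ(X) ≤ ν_r ≤ b_{2r}`** (`finrank_tateClasses_le_card_isOfFinOrder`).

## References

* [Milne2007TateFiniteFieldsAIM] J. S. Milne, arXiv:0709.3040, §1 p. 3, Th. 1.2.
* [Tate1994] J. Tate, *Conjectures on algebraic cycles in ℓ-adic cohomology*, PSPM 55.1, §1.
* [Schuett2013TwoLecturesK3] M. Schütt, *Two Lectures on the Arithmetic of K3 Surfaces*, §6.

## Provenance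

Lane `lit-hodgefound` (summit `HodgeConjecture`, Track 2 foundations library, Layer B: motives),
seat `lit-hodgefound-p29` (literature-prover, generation 42, row g42-#9).
-/

universe u v

open CategoryTheory AlgebraicGeometry Polynomial

noncomputable section

namespace Literature.AlgebraicGeometry.Motives

open Literature.LinearAlgebra Literature.AlgebraicGeometry.Kahn2003
open Literature.NumberTheory.LFunctions

namespace GaloisWeilCohomology

variable {k : Type u} [Field k] [Finite k] {K : Type v} [Field K] [CharZero K]
  {χ : Field.absoluteGaloisGroup k →* Kˣ} (E : GaloisWeilCohomology k K χ)
variable {d : ℕ} {X : SchemeOver k}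

/-- **The Tate classes are fixed by the Frobenius of a finite extension**: there is `N ≥ 1` such that
for every `m` with `N ∣ m`, `𝒯ʳ(X) ≤ Ker(φ_r^m − 1)`, `φ_r^m = ρTwist(F^m)` the twisted Frobenius relative
to `𝔽_{q^m}` (Milne: the Tate classes are `⋃_{k₁} H^{Gal(𝔽/k₁)}`, and one `k₁` suffices).
[cite: Milne2007TateFiniteFieldsAIM, §1 p. 3] [cite: Tate1994, §1] -/
theorem exists_tateClasses_le_ker_pow (hX : IsSmoothProjective d X) (r : ℕ) :
    ∃ N : ℕ, 0 < N ∧ ∀ m : ℕ, N ∣ m →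
      E.tateClasses X r ≤ LinearMap.ker (E.ρTwist X (2 * r) r (geomFrob k ^ m) - 1) := by
  obtain ⟨N, hN, hfix, -⟩ := E.exists_forall_ρTwist_apply_eq_pow_apply hX r
  refine ⟨N, hN, fun m hm x hx => ?_⟩
  obtain ⟨e, rfl⟩ := hm
  have hiter : ∀ e : ℕ, ((E.ρTwist X (2 * r) r (geomFrob k) ^ N) ^ e) x = x := by
    intro e
    induction e with
    | zero => rw [pow_zero, Module.End.one_apply]
    | succ e ih => rw [pow_succ, Module.End.mul_apply, hfix x hx, ih]
  rw [LinearMap.mem_ker, LinearMap.sub_apply, Module.End.one_apply, map_pow, pow_mul, hiter e, sub_self]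

/-- **`𝒯ʳ(X) ≤ H^{2r}(X)(r)_{(φ_r^m),1}`** for `N ∣ m`: the Tate classes lie in the generalized
`1`-eigenspace of the Frobenius relative to `𝔽_{q^m}`. [cite: Milne2007TateFiniteFieldsAIM, §1 p. 3]
[cite: Tate1994, §1] -/
theorem exists_tateClasses_le_maxGenEigenspace_pow (hX : IsSmoothProjective d X) (r : ℕ) :
    ∃ N : ℕ, 0 < N ∧ ∀ m : ℕ, N ∣ m →
      E.tateClasses X r ≤ Module.End.maxGenEigenspace (E.ρTwist X (2 * r) r (geomFrob k ^ m)) 1 := by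
  obtain ⟨N, hN, h⟩ := E.exists_tateClasses_le_ker_pow hX r
  refine ⟨N, hN, fun m hm x hx => ?_⟩
  have hx' := h m hm hx
  rw [LinearMap.mem_ker] at hx'
  rw [Module.End.mem_maxGenEigenspace]
  exact ⟨1, by rw [pow_one, one_smul]; exact hx'⟩

omit [Finite k] in
/-- **`dim_K K·Aʳ(X) ≤ dim_K 𝒯ʳ(X)`**: algebraic classes are Tate classes. [cite: Tate1994, §1]
[cite: Milne2007TateFiniteFieldsAIM, §1 p. 3] -/
theorem finrank_algebraicClasses_le_finrank_tateClasses (hX : IsSmoothProjective d X) (r : ℕ) :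
    Module.finrank K (E.algebraicClasses X r) ≤ Module.finrank K (E.tateClasses X r) := by
  haveI := E.finite_obj hX (2 * r)
  exact Submodule.finrank_mono (algebraicClasses_le_tateClasses E hX r)

/-- **`dim_K 𝒯ʳ(X) ≤ dim_K H^{2r}(X)(r)_{(φ_r^m),1}` for `N ∣ m`.** [cite: Milne2007TateFiniteFieldsAIM, §1 p. 3]
[cite: Tate1994, §1] -/
theorem exists_finrank_tateClasses_le (hX : IsSmoothProjective d X) (r : ℕ) :
    ∃ N : ℕ, 0 < N ∧ ∀ m : ℕ, N ∣ m →
      Module.finrank K (E.tateClasses X r) ≤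
        Module.finrank K (Module.End.maxGenEigenspace (E.ρTwist X (2 * r) r (geomFrob k ^ m)) 1) := by
  haveI := E.finite_obj hX (2 * r)
  obtain ⟨N, hN, h⟩ := E.exists_tateClasses_le_maxGenEigenspace_pow hX r
  exact ⟨N, hN, fun m hm => Submodule.finrank_mono (h m hm)⟩

/-- **`dim_K 𝒯ʳ(X) ≤ ord_{t=(q^m)^{-r}} Z(X ⊗ 𝔽_{q^m}, t)` for all `m ≥ 1` divisible by some `N ≥ 1`**, under
the trace formula, `χ(φ) = q` and the Riemann hypothesis for `X` (`r ≤ d`): Milne's «for any model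
`X₁/k₁`, the subspace `H^{Gal(𝔽/k₁)}` is spanned by the classes of algebraic cycles on `X₁`» would make this
an equality with the rank over `k₁ = 𝔽_{q^m}`. [cite: Milne2007TateFiniteFieldsAIM, §1 p. 3 and Th. 1.2]
[cite: Tate1994, §1 and §2 Th. 2.9] -/
theorem exists_finrank_tateClasses_le_poleOrder_pow (hE : E.HasLefschetzTraceFormula)
    (hχ : ((χ (arithFrob k) : Kˣ) : K) = Nat.card k) (hX : IsSmoothProjective d X)
    (hRH : E.WeilRiemannHypothesisFor X d) {r : ℕ} (hr : r ≤ d) :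
    ∃ N : ℕ, 0 < N ∧ ∀ m : ℕ, N ∣ m → 0 < m →
      ∃ ρ : ℕ, HasPoleOfOrderAt (zetaSeriesPow X m) ((((Nat.card k : ℚ) ^ m) ^ r)⁻¹) ρ ∧
        Module.finrank K (E.tateClasses X r) ≤ ρ := by
  obtain ⟨N, hN, h⟩ := E.exists_finrank_tateClasses_le hX r
  exact ⟨N, hN, fun m hm hm0 =>
    ⟨_, E.hasPoleOfOrderAt_zetaSeriesPow hE hχ hX hRH hr hm0, h m hm⟩⟩

open Classical in
/-- **`dim_K 𝒯ʳ(X) ≤ ν_r = #{j : α_{2r,j}/q^r ∈ μ_∞} ≤ b_{2r}`** (for an explicit integral model `P_{2r}` of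
`det(1 − tF | H^{2r}(X))` with the Riemann hypothesis): the Tate classes have eigenvalues `ζ q^r`
(«eigenvalues … take the shape `ζq` where `ζ` runs through roots of unity»).
[cite: Schuett2013TwoLecturesK3, §6 p. 79] [cite: Milne2007TateFiniteFieldsAIM, §1 p. 3] -/
theorem finrank_tateClasses_le_card_isOfFinOrder (hE : E.HasLefschetzTraceFormula)
    (hχ : ((χ (arithFrob k) : Kˣ) : K) = Nat.card k) (hX : IsSmoothProjective d X)
    {P : Fin (2 * d + 1) → ℤ[X]} (hP : ∀ i : Fin (2 * d + 1), E.IsIntegralModel X i (P i))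
    (hroots : ∀ (i : Fin (2 * d + 1)) (z : ℂ), ((P i).map (Int.castRingHom ℂ)).IsRoot z →
      ‖z‖ = (Nat.card k : ℝ) ^ (-((i : ℕ) : ℝ) / 2)) {r : ℕ} (hr : r ≤ d) :
    Module.finrank K (E.tateClasses X r) ≤
      Multiset.card (((P ⟨2 * r, by omega⟩).map (Int.castRingHom ℂ)).roots.filter
        fun z => IsOfFinOrder (z * (Nat.card k : ℂ) ^ r)) ∧
    Multiset.card (((P ⟨2 * r, by omega⟩).map (Int.castRingHom ℂ)).roots.filter
        fun z => IsOfFinOrder (z * (Nat.card k : ℂ) ^ r)) ≤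
      (haveI := E.finite_obj hX (2 * r); Module.finrank K (E.obj X (2 * r))) := by
  obtain ⟨N, hN, h⟩ := E.exists_finrank_tateClasses_le hX r
  exact ⟨(h N (dvd_refl N)).trans
      (E.finrank_maxGenEigenspace_ρTwist_pow_le_card_isOfFinOrder hE hχ hX hP hroots hr hN),
    (E.card_isOfFinOrder_le_finrank_and_even_sub hE hχ hX hP hroots hr).1⟩

end GaloisWeilCohomology

end Literature.AlgebraicGeometry.Motives

end
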